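import Summits.QuantumFields.YangMills.Theorems.UnitScaleTiltBlockAvgCorrector
import Literature.MathematicalPhysics.QuantumFieldTheory.Balaban1983to89.BlockAveragingExpMeanLogContinuous
import HarnessLib

/-!
# Route `UnitScaleTilt` (rung R3), crux K1bR-pr «FluctuationComparisonRegPr» (stmt-QuantumFields-19201): THE OPEN-MAP HALF (O) OF THE
# ONE-STEP SUBMERSION — Bałaban's block averaging (0.4) with the printed exp-mean-log average maps open sets of small fields to
# open sets, on every torus of the d = 3 family on `SU(2)`, with a radius depending on the block size alone

Cell `ym3-torus` (HUMAN RULING D-0037, YM ladder rung R3), seat `ym3-torus-p1` gen 9; cell record HOME/UV3-NODE.md §18.  WHAT THIS IS NOT: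
not the measure-open half (N) of the submersion and not «Lemma B»; nothing of Bałaban's is asserted (Bałaban never needs (0.4) to be
open or onto).  It is the hypothesis (O) of `UnitScaleTiltFluctuationComparisonRegPrPosOnSmallReduction.posOnSmall_of_smallLift_of_oneStepSubmersion`
(first conjunct of `hsub`), VERBATIM in shape, discharged from the exact corrector `UnitScaleTiltBlockAvgCorrector.exists_corrector_T3`:
the image of an open subset `O` of the `δ₁`-small fields contains, about each of its points `Ū₀` (`U₀ ∈ O`), the uniform ball
`{V : ‖V(c) − Ū₀(c)‖ < η}` — every such `V` is `Ū′` for a `U′` within `Cη < ε` of `U₀` bond by bond, hence in `O`.  `δ₁ = t₀/2`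
with `t₀ = (3600(L+1)⁵)⁻¹`, `C = 72L³` the corrector's constants.  Elementary topology of the finite product `SU(2)^{bonds}`.

References: T. Bałaban, CMP 109 (1987) 249–301 [Balaban1987RG1] ((0.4), (0.18) p.253–255).
-/

noncomputable section

open scoped Matrix.Norms.L2Operator
open Function Set Filter Topology Metric

namespace Summit.QuantumFields.YangMills.Theorems.BlockAvgCorrector

open Literature.MathematicalPhysics.QuantumFieldTheory.Balaban1983to89
open BlockAveraging BlockAveragingHaarAC T3ContinuumYM3Torus
open T3UnitLawDensityEML (ℰp)

/-- In the matrix model the distance of `SU(2)` is the operator-norm distance of the matrices. [folklore] -/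
private theorem dist_eq_norm_coe (g h : Matrix.specialUnitaryGroup (Fin 2) ℂ) :
    dist g h = ‖(g : Matrix (Fin 2) (Fin 2) ℂ) - (h : Matrix (Fin 2) (Fin 2) ℂ)‖ := by
  rw [Subtype.dist_eq, dist_eq_norm]

/-- **(O) — BAŁABAN'S BLOCK AVERAGING IS AN OPEN MAP ON THE SMALL FIELDS** (d = 3 family, `SU(2)`, printed exp-mean-log average):
for every block size `L` there is `δ₁ > 0` such that on every torus of every run of every member of the family with block size
`L` (standing range `j + 1 ≤ m + K`) the image under (0.4) of every open subset of the `δ₁`-small fields is open.  This is the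
first conjunct of the one-step submersion hypothesis `hsub` of
`PosOnSmallReduction.posOnSmall_of_smallLift_of_oneStepSubmersion`, in its shape. NOT PRINTED. [cite: Balaban1987RG1, (0.4)/(0.18) p.253] -/
theorem exists_isOpen_image_blockAvg_T3 (L : ℕ) : ∃ δ₁ : ℝ, 0 < δ₁ ∧ ∀ F : T3Family, F.L = L → ∀ K j : ℕ, j + 1 ≤ F.m + K →
    ∀ O : Set (GaugeField (F.P K) j (Matrix.specialUnitaryGroup (Fin 2) ℂ)), IsOpen O → O ⊆ {U | PlaqSmall δ₁ U} →
      IsOpen ((BlockAveraging.blockAvg (P := F.P K) (j := j) ℰp).avg '' O) := by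
  obtain ⟨t₀, C, ht₀, hC, hcorr⟩ := exists_corrector_T3 L
  refine ⟨t₀ / 2, by positivity, fun F hFL K j hj O hO hOsmall => ?_⟩
  rw [blockAvg_avg]
  -- the product (sup) metric on configurations; its topology is the product topology of `GaugeField`
  letI : PseudoMetricSpace (GaugeField (F.P K) j (Matrix.specialUnitaryGroup (Fin 2) ℂ)) :=
    inferInstanceAs (PseudoMetricSpace (PBond (F.P K) j → Matrix.specialUnitaryGroup (Fin 2) ℂ))
  letI : PseudoMetricSpace (GaugeField (F.P K) (j + 1) (Matrix.specialUnitaryGroup (Fin 2) ℂ)) :=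
    inferInstanceAs (PseudoMetricSpace (PBond (F.P K) (j + 1) → Matrix.specialUnitaryGroup (Fin 2) ℂ))
  rw [Metric.isOpen_iff] at hO ⊢
  rintro V₀ ⟨U₀, hU₀, rfl⟩
  obtain ⟨ε, hε, hball⟩ := hO U₀ hU₀
  -- the radius of the image ball
  set η : ℝ := min (ε / (2 * (C + 1))) (t₀ / (2 * (C + 1))) with hη_def
  have hC1 : 0 < C + 1 := by linarith
  have hη : 0 < η := lt_min (by positivity) (by positivity)
  have hηε : C * η < ε := by
    have h1 : η ≤ ε / (2 * (C + 1)) := min_le_left _ _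
    have h2 : C * η ≤ C * (ε / (2 * (C + 1))) := mul_le_mul_of_nonneg_left h1 hC
    have h3 : C * (ε / (2 * (C + 1))) < ε := by
      rw [mul_div_assoc', div_lt_iff₀ (by positivity)]; nlinarith
    linarith
  have hηt : t₀ / 2 + C * η ≤ t₀ := by
    have h1 : η ≤ t₀ / (2 * (C + 1)) := min_le_right _ _
    have h2 : C * η ≤ C * (t₀ / (2 * (C + 1))) := mul_le_mul_of_nonneg_left h1 hC
    have h3 : C * (t₀ / (2 * (C + 1))) ≤ t₀ / 2 := by
      rw [mul_div_assoc', div_le_iff₀ (by positivity)]; nlinarith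
    linarith
  refine ⟨η, hη, fun V hV => ?_⟩
  -- `V` is `η`-close to `Ū₀` bond by bond
  have hV' : ∀ c, ‖((V c : Matrix.specialUnitaryGroup (Fin 2) ℂ) : Matrix (Fin 2) (Fin 2) ℂ) -
      ((avgFun ℰp U₀ c : Matrix.specialUnitaryGroup (Fin 2) ℂ) : Matrix (Fin 2) (Fin 2) ℂ)‖ ≤ η := by
    intro c
    have h := (dist_pi_lt_iff hη).mp (mem_ball.mp hV) c
    rw [dist_eq_norm_coe] at h
    exact h.le
  obtain ⟨U', hU'V, -, hU'U, -⟩ := hcorr F hFL K j hj (t₀ / 2) η (by positivity) hη.le hηt U₀ (hOsmall hU₀) V hV'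
  refine ⟨U', hball ?_, hU'V⟩
  -- `U′` is within `Cη < ε` of `U₀`, hence in `O`
  exact mem_ball.mpr ((dist_pi_lt_iff hε).mpr fun b => by rw [dist_eq_norm_coe]; exact (hU'U b).trans_lt hηε)

end Summit.QuantumFields.YangMills.Theorems.BlockAvgCorrector

end
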